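import Literature.AlgebraicGeometry.AbelianSchemes.AbelianSchemeQuotientDualPairDiscrepancy
import Literature.AlgebraicGeometry.RelativeSpec.GeometricQuotientFreeTorsor
import Mathlib.LinearAlgebra.LinearIndependent.Lemmas
import HarnessLib

/-!
# The level twists: at a geometric point the discrepancy characters hit `1` (HECKE-LINK H2, D6 (u1)+(u2), part 3 — the character correction)

Layer `Literature/AlgebraicGeometry/AbelianSchemes`, namespace `Literature.AlgebraicGeometry.AbelianSchemes.AbelianSchemeOver`.
THEOREMS ONLY; no definition, no named fact, no instance, no notation, no `sorry`.

Setting of parts 1–2 (★ `AbelianSchemeQuotientDualPairDivision`, ★ `AbelianSchemeQuotientDualPairDiscrepancy`).  [MumfordAV1970] §15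
Thm. 1 («the dual of `A/K` is `Â/K^⊥`»): an `n`-th root `a₁` of the classifying map of `ψ^*ℒ` classifies `ℒ` only up to a CHARACTER of
`K` (the `K`-descent datum), and the `n`-torsion points of `Â` surject onto these characters with kernel `K′ = K^⊥`.  Here, WITHOUT a
Weil pairing: twist `a₁` by the level sections `φ̂(c)`, `c ∈ (ℤ/n)^{2g}` (★ `LevelStructure`); at a geometric point `τ` of `T₁` the map
`c ↦ (σ ↦ τ^♯ v_c σ) ∈ Hom(K, Ω)` (discrepancy units `v_c` of part 2) has

* fibres inside `K′`-cosets — **`exists_comp_eq_comp_translation_of_appTop_eq`**: equal values at `τ` ⇒ `(1 × τa)^*𝒩₁ ≅ (1 × τa′)^*𝒩₁` on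
  `B_Ω` (★ junction `nonempty_pullback_iso_of_discrepancy_appTop_eq`) ⇒ `τa ≫ ψ̂ = τa′ ≫ ψ̂` by the stabiliser hypothesis (K) `hStab`
  (★ `PoincarePullbackStabilizerOfChar`) ⇒ `τa′ = τa ≫ t_{κ′}`, `κ′ ∈ K′` (★ `exists_eq_comp_aut_of_comp_eq_of_free`);
* a domain of `n^{2g} = #K · #K′` elements (`φ̂.basis_injective`, hypothesis `hcard`) and a target of at most `#K` (Dedekind–Artin),

so it is ONTO and hits the trivial character — **`exists_mem_basicOpen_levelTwist`**: every point of `T₁` lies in some open piece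
`G_c = D(∏_σ Σ_{i<n} (v_c σ)^i)`.

Cell `hodgecm-mathlib`, HECKE-LINK socket (B) file (ii), D6 brick (u1)+(u2) «EXISTENCE half of the universal property of the dual
pair of `A/K`» (B-plan1 (g14) 2026-08-29; design review B-p20 (g9); generic engine ★ `RelativeSpec/PullbackIsoDiscrepancy`, B-p07 (g14)).
HC_CM is proved only modulo the 7 printed citations until rung 0 closes; nothing here is about HC.

## References
* [MumfordAV1970] D. Mumford, *Abelian Varieties* (1970), §7 Thm. 4 (p. 72), §12 Thm. 1 (p. 112), §15 Thm. 1 (p. 143).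
* [MilneAV2008] J. S. Milne, *Abelian Varieties* (2008), I §8 (pp. 36–37), I §9 Thm. 9.1 (p. 42).
* [MumfordFogartyKirwan1994] D. Mumford, J. Fogarty, F. Kirwan, *GIT*, 3rd ed., Ch. 1 §3 Def. 1.6 (p. 30), Ch. 7 §2 Def. 7.1 (p. 129).
* [Greither1992CyclicGalois] C. Greither, LNM 1534 (1992), Ch. 0 Prop. 7.2 (p. 29).
* [GortzWedhorn2020] U. Görtz, T. Wedhorn, *Algebraic Geometry I*, 2nd ed. (2020), Section (4.7), Thm. 14.72.
-/

noncomputable section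

-- `(A.baseChange f).X = (Over.pullback f).obj A.X` / `(A.X ⊗ B.X).left = A.prodLeft B` hold by `rfl` only.
set_option backward.isDefEq.respectTransparency false

universe u

open CategoryTheory CategoryTheory.Limits AlgebraicGeometry MonoidalCategory CartesianMonoidalCategory
open scoped MonObj

namespace Literature.AlgebraicGeometry.AbelianSchemes

namespace AbelianSchemeOver

open Literature.AlgebraicGeometry.RelativeSpec Literature.AlgebraicGeometry.AbelianVarieties
  Literature.AlgebraicGeometry.Motives Literature.AlgebraicGeometry.Modules

/-! ## §0 (private) Counting tools and a membership criterion for basic opens -/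

section Counting

/-- **Dedekind–Artin**: a finite group has at most `#K` characters with values in a field (distinct characters are linearly
independent, Mathlib `linearIndependent_monoidHom`, inside the `#K`-dimensional space of functions `K → Ω`). [folklore] -/
private theorem finite_monoidHom_and_natCard_le (K : Type u) [Group K] [Finite K] (Ω : Type u) [Field Ω] :
    Finite (K →* Ω) ∧ Nat.card (K →* Ω) ≤ Nat.card K := by
  classical
  haveI := Fintype.ofFinite K
  have hli := linearIndependent_monoidHom K Ω
  haveI : Finite (K →* Ω) := hli.finite
  haveI := Fintype.ofFinite (K →* Ω)
  refine ⟨inferInstance, ?_⟩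
  have h := hli.fintype_card_le_finrank
  rw [Module.finrank_fintype_fun_eq_card] at h
  rwa [Nat.card_eq_fintype_card, Nat.card_eq_fintype_card]

/-- **Pigeonhole for a map with small fibres onto a small target**: if `d : X → H` has all fibres of size `≤ q`, `#X = m · q`,
`0 < q` and `#H ≤ m` (everything finite), then `d` is surjective. [folklore] -/
private theorem surjective_of_card_fibre_le {X H : Type*} [Finite X] [Finite H] (d : X → H) {m q : ℕ} (hq : 0 < q)
    (hX : Nat.card X = m * q) (hH : Nat.card H ≤ m) (hfib : ∀ h : H, Nat.card {x // d x = h} ≤ q) :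
    Function.Surjective d := by
  classical
  haveI := Fintype.ofFinite X
  haveI := Fintype.ofFinite H
  -- if `h₀` is missed then `#X = Σ_{h ≠ h₀} #fibre(h) ≤ (#H - 1) · q ≤ (m - 1) · q < m · q = #X`
  by_contra hs
  simp only [Function.Surjective, not_forall, not_exists] at hs
  obtain ⟨h₀, hh₀⟩ := hs
  have hfib' : ∀ h : H, (Finset.univ.filter fun x => d x = h).card ≤ q := fun h => by
    have := hfib h
    rwa [Nat.card_eq_fintype_card, Fintype.card_subtype] at this
  have hmaps : ∀ x ∈ (Finset.univ : Finset X), d x ∈ Finset.univ.erase h₀ := fun x _ =>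
    Finset.mem_erase.mpr ⟨hh₀ x, Finset.mem_univ _⟩
  have hsum := Finset.card_eq_sum_card_fiberwise hmaps
  have hle : Fintype.card X ≤ (Fintype.card H - 1) * q := by
    rw [← Finset.card_univ, hsum]
    calc ∑ h ∈ Finset.univ.erase h₀, (Finset.univ.filter fun x => d x = h).card
        ≤ ∑ _h ∈ Finset.univ.erase h₀, q := Finset.sum_le_sum fun h _ => hfib' h
      _ = (Fintype.card H - 1) * q := by
          rw [Finset.sum_const, smul_eq_mul, Finset.card_erase_of_mem (Finset.mem_univ _), Finset.card_univ]
  rw [Nat.card_eq_fintype_card] at hX hH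
  have hH1 : 1 ≤ Fintype.card H := Fintype.card_pos_iff.mpr ⟨h₀⟩
  have hm : 1 ≤ m := hH1.trans hH
  have h1 : q ≤ m * q := Nat.le_mul_of_pos_left q hm
  have h2 : (m - 1) * q = m * q - q := Nat.sub_one_mul m q
  have h3 : m * q ≤ (m - 1) * q :=
    (hX.symm.le.trans hle).trans (Nat.mul_le_mul_right q (Nat.sub_le_sub_right hH 1))
  rw [h2] at h3
  omega

/-- `n` invertible in a field `Ω` is a unit of `Γ(Spec Ω, 𝒪)`. [folklore] -/
private theorem isUnit_natCast_ΓSpec {Ω : Type u} [Field Ω] {n : ℕ} (hn : (n : Ω) ≠ 0) :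
    IsUnit (n : Γ(Spec (CommRingCat.of Ω), ⊤)) := by
  let e : Γ(Spec (CommRingCat.of Ω), ⊤) ≃+* Ω := (Scheme.ΓSpecIso (.of Ω)).commRingCatIsoToRingEquiv
  have h1 : IsUnit (e.symm (n : Ω)) := (isUnit_iff_ne_zero.mpr hn).map e.symm
  rwa [map_natCast] at h1

/-- **A point at which a global function pulls back to a unit lies in its basic open**: for `τ : Spec Ω → X` with
`τ^♯ r` a unit of `Γ(Spec Ω, 𝒪)`, every point of `Spec Ω` maps into `X.basicOpen r` (Mathlib `Scheme.preimage_basicOpen`). [folklore] -/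
private theorem mem_basicOpen_of_isUnit_appTop {X : Scheme.{u}} {Ω : Type u} [Field Ω] (τ : Spec (.of Ω) ⟶ X)
    (r : Γ(X, ⊤)) (hr : IsUnit (τ.appTop r)) (x : Spec (CommRingCat.of Ω)) : τ.base x ∈ X.basicOpen r := by
  have hr' : IsUnit (τ.app ⊤ r) := hr
  have hpre : x ∈ τ ⁻¹ᵁ (X.basicOpen r) := by
    rw [Scheme.preimage_basicOpen, (Spec (CommRingCat.of Ω)).basicOpen_of_isUnit hr']
    exact TopologicalSpace.Opens.mem_top _
  exact hpre

end Counting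

/-! ## §4 At a geometric point: equal discrepancies force the lifts to differ by `K′` -/

section Fibre

variable {S : Scheme.{u}} (A : AbelianSchemeOver S)
  {Y : Scheme.{u}} (u : S ⟶ Y) (K : Subgroup A.Sections) [IsCommMonObj A.X] {n : ℕ}
  (hK : ∀ σ : K, (σ : A.Sections) ^ n = 1)
  [Finite K] [Y.IsSeparated] [IsSeparated (A.X.hom ≫ u)] [S.IsSeparated]
  (hcov : ∀ x : A.left, ∃ O : (A.translationActionOver u K).StableAffineOpens, x ∈ O.1)
  [LocallyOfFiniteType (A.X.hom ≫ u)] [IsLocallyNoetherian Y]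
  (hG : ∃ _ : GrpObj (A.quotientOver u K), IsMonHom (A.quotientMk u K hcov))
  (hsm : Smooth (A.quotientOver u K).hom) (hgc : GeometricallyConnected (A.quotientOver u K).hom)
  (D : A.DualPair) [IsAffine Y]
  (hfree : ∀ (Ω : Type u) [Field Ω] [IsAlgClosed Ω] (x : Spec (.of Ω) ⟶ A.left) (σ : K), σ ≠ 1 →
    x ≫ (A.translation (σ : A.Sections)).left ≠ x)
  (K' : Subgroup D.hat.Sections) [Finite K'] [IsSeparated (D.hat.X.hom ≫ u)]
  (hcov' : ∀ x : D.hat.left, ∃ O : (D.hat.translationActionOver u K').StableAffineOpens, x ∈ O.1)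
  (hfree' : ∀ (Ω : Type u) [Field Ω] [IsAlgClosed Ω] (x : Spec (.of Ω) ⟶ D.hat.left) (σ : K'), σ ≠ 1 →
    x ≫ (D.hat.translation (σ : D.hat.Sections)).left ≠ x)

include hfree hfree' in
/-- **EQUAL DISCREPANCIES AT A GEOMETRIC POINT ⇒ THE TWO LIFTS DIFFER BY `K′`.**  Let `a, a′ : T₁ → Â` be two `T₁`-valued points
over `f₁`, `F₀` a line bundle on `B_{T₁}`, `e : ψ^*((1 × a)^*𝒩₁) ≅ ψ^* F₀`, `e′ : ψ^*((1 × a′)^*𝒩₁) ≅ ψ^* F₀` with discrepancy units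
`v, v′` (§3), and `τ : Spec Ω → T₁` a field-valued point at which `v σ` and `v′ σ` take the same values for all `σ`.  Then
`τ ≫ a′ = (τ ≫ a) ≫ t_{κ′}` for some `κ′ ∈ K′`: restricting to `A_Ω → B_Ω` (★ `discrepancy_restrict`) both isomorphisms land in
`ψ_Ω^*(F₀|_{B_Ω})` with the SAME discrepancies, so `(1 × τa)^*𝒩₁ ≅ (1 × τa′)^*𝒩₁` on `B_Ω` (★ `exists_iso_of_discrepancy_eq`), hence
`τa ≫ ψ̂ = τa′ ≫ ψ̂` by the stabiliser hypothesis (K) `hStab`, and the fibres of the free quotient `ψ̂ : Â → Â/K′` on field-valued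
points are `K′`-orbits (★ `exists_eq_comp_aut_of_comp_eq_of_free`). [cite: MumfordAV1970, §15 Thm. 1 (p. 143)]
[cite: MumfordAV1970, §7 Thm. p. 66 (1)] [cite: Greither1992CyclicGalois, Ch. 0 Prop. 7.2 (p. 29)] -/
theorem exists_comp_eq_comp_translation_of_appTop_eq
    (hStab : ∀ {T : Scheme.{u}} (f : T ⟶ S) (a a' : T ⟶ D.hat.X.left) (ha : a ≫ D.hat.X.hom = f)
      (ha' : a' ≫ D.hat.X.hom = f),
      Nonempty ((Scheme.Modules.pullback ((A.quotientBy u K hcov hG hsm hgc).baseChangeToProd D.hat f a ha)).obj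
          (A.poincarePullbackBundle u K hK hcov hG hsm hgc D hfree).L ≅
        (Scheme.Modules.pullback ((A.quotientBy u K hcov hG hsm hgc).baseChangeToProd D.hat f a' ha')).obj
          (A.poincarePullbackBundle u K hK hcov hG hsm hgc D hfree).L) →
      a ≫ (D.hat.quotientMk u K' hcov').left = a' ≫ (D.hat.quotientMk u K' hcov').left)
    {T₁ : Scheme.{u}} (f₁ : T₁ ⟶ S) (F₀ : ((A.quotientBy u K hcov hG hsm hgc).baseChange f₁).X.left.Modules) (h₀ : HasRank F₀ 1)
    (a a' : T₁ ⟶ D.hat.X.left) (ha : a ≫ D.hat.X.hom = f₁) (ha' : a' ≫ D.hat.X.hom = f₁)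
    (e : (Scheme.Modules.pullback (A.quotientMk u K hcov ▷ Over.mk f₁).left).obj
        ((Scheme.Modules.pullback ((A.quotientBy u K hcov hG hsm hgc).baseChangeToProd D.hat f₁ a ha)).obj
          (A.poincarePullbackBundle u K hK hcov hG hsm hgc D hfree).L) ≅
      (Scheme.Modules.pullback (A.quotientMk u K hcov ▷ Over.mk f₁).left).obj F₀)
    (e' : (Scheme.Modules.pullback (A.quotientMk u K hcov ▷ Over.mk f₁).left).obj
        ((Scheme.Modules.pullback ((A.quotientBy u K hcov hG hsm hgc).baseChangeToProd D.hat f₁ a' ha')).obj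
          (A.poincarePullbackBundle u K hK hcov hG hsm hgc D hfree).L) ≅
      (Scheme.Modules.pullback (A.quotientMk u K hcov ▷ Over.mk f₁).left).obj F₀)
    (v v' : K → Γ(T₁, ⊤))
    (hv : ∀ σ : K,
      (Scheme.Modules.pullback ((translationActionOverWhiskerRight A (Over.mk f₁) u K hcov).autHom σ)).map e.hom ≫
          ((ActionOver.EquivariantStructure.ofPullback (translationActionOverWhiskerRight A (Over.mk f₁) u K hcov) F₀).iso σ).hom =
        ((ActionOver.EquivariantStructure.ofPullback (translationActionOverWhiskerRight A (Over.mk f₁) u K hcov)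
          ((Scheme.Modules.pullback ((A.quotientBy u K hcov hG hsm hgc).baseChangeToProd D.hat f₁ a ha)).obj
          (A.poincarePullbackBundle u K hK hcov hG hsm hgc D hfree).L)).iso σ).hom ≫
          e.hom ≫ globalScalar ((Scheme.Modules.pullback (A.quotientMk u K hcov ▷ Over.mk f₁).left).obj F₀) ((A.baseChange f₁).X.hom.appTop (v σ)))
    (hv' : ∀ σ : K,
      (Scheme.Modules.pullback ((translationActionOverWhiskerRight A (Over.mk f₁) u K hcov).autHom σ)).map e'.hom ≫
          ((ActionOver.EquivariantStructure.ofPullback (translationActionOverWhiskerRight A (Over.mk f₁) u K hcov) F₀).iso σ).hom =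
        ((ActionOver.EquivariantStructure.ofPullback (translationActionOverWhiskerRight A (Over.mk f₁) u K hcov)
          ((Scheme.Modules.pullback ((A.quotientBy u K hcov hG hsm hgc).baseChangeToProd D.hat f₁ a' ha')).obj
          (A.poincarePullbackBundle u K hK hcov hG hsm hgc D hfree).L)).iso σ).hom ≫
          e'.hom ≫ globalScalar ((Scheme.Modules.pullback (A.quotientMk u K hcov ▷ Over.mk f₁).left).obj F₀) ((A.baseChange f₁).X.hom.appTop (v' σ)))
    {Ω : Type u} [Field Ω] (τ : Spec (.of Ω) ⟶ T₁) (hτ : ∀ σ : K, τ.appTop (v σ) = τ.appTop (v' σ)) :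
    ∃ κ' : K', τ ≫ a' = (τ ≫ a) ≫ (D.hat.translation (κ' : D.hat.Sections)).left := by
  classical
  letI : Fintype K := Fintype.ofFinite K
  letI : Fintype K' := Fintype.ofFinite K'
  let B : AbelianSchemeOver S := A.quotientBy u K hcov hG hsm hgc
  have h₁ : HasRank ((Scheme.Modules.pullback ((A.quotientBy u K hcov hG hsm hgc).baseChangeToProd D.hat f₁ a ha)).obj
          (A.poincarePullbackBundle u K hK hcov hG hsm hgc D hfree).L) 1 :=
    hasRank_pullback _ (A.poincarePullbackBundle u K hK hcov hG hsm hgc D hfree).hasRank_one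
  have h₁' : HasRank ((Scheme.Modules.pullback ((A.quotientBy u K hcov hG hsm hgc).baseChangeToProd D.hat f₁ a' ha')).obj
          (A.poincarePullbackBundle u K hK hcov hG hsm hgc D hfree).L) 1 :=
    hasRank_pullback _ (A.poincarePullbackBundle u K hK hcov hG hsm hgc D hfree).hasRank_one
  -- the discrepancies have the same pull-backs along `A_Ω → A_{T₁}`
  have hrr : ∀ σ : K, (A.prodMap (τ ≫ f₁) f₁ τ rfl).appTop ((A.baseChange f₁).X.hom.appTop (v σ)) =
      (A.prodMap (τ ≫ f₁) f₁ τ rfl).appTop ((A.baseChange f₁).X.hom.appTop (v' σ)) := by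
    intro σ
    change ((A.baseChange f₁).X.hom.appTop ≫ (A.prodMap (τ ≫ f₁) f₁ τ rfl).appTop) (v σ) =
      ((A.baseChange f₁).X.hom.appTop ≫ (A.prodMap (τ ≫ f₁) f₁ τ rfl).appTop) (v' σ)
    rw [← Scheme.Hom.comp_appTop, A.prodMap_comp_baseChange_hom _ f₁ τ rfl, Scheme.Hom.comp_appTop,
      CommRingCat.comp_apply, CommRingCat.comp_apply, hτ]
  -- descent over `Spec Ω` (generic `nonempty_pullback_iso_of_discrepancy_appTop_eq`)
  haveI : IsAffineHom (A.quotientMk u K hcov ▷ Over.mk (τ ≫ f₁)).left :=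
    isAffineHom_whiskerRight_quotientMk_left A (Over.mk (τ ≫ f₁)) u K hcov
  haveI : Flat (A.quotientMk u K hcov ▷ Over.mk (τ ≫ f₁)).left :=
    A.flat_whiskerRight_quotientMk_left (Over.mk (τ ≫ f₁)) u K hcov hfree
  obtain ⟨i⟩ := ActionOver.nonempty_pullback_iso_of_discrepancy_appTop_eq
    (translationActionOverWhiskerRight A (Over.mk f₁) u K hcov)
    (translationActionOverWhiskerRight A (Over.mk (τ ≫ f₁)) u K hcov) (A.prodMap (τ ≫ f₁) f₁ τ rfl) (B.prodMap (τ ≫ f₁) f₁ τ rfl)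
    (A.whiskerRight_left_comp_prodMap B (τ ≫ f₁) f₁ τ rfl (A.quotientMk u K hcov)).symm
    (fun σ : K => A.whiskerRight_left_comp_prodMap A (τ ≫ f₁) f₁ τ rfl (A.translation ((σ : K) : A.Sections)))
    (isGeometricQuotient_translationActionOverWhiskerRight A (Over.mk (τ ≫ f₁)) u K hcov hfree)
    (translationActionOverWhiskerRight_free A (Over.mk (τ ≫ f₁)) u K hcov hfree)
    F₀ ((Scheme.Modules.pullback ((A.quotientBy u K hcov hG hsm hgc).baseChangeToProd D.hat f₁ a ha)).obj
          (A.poincarePullbackBundle u K hK hcov hG hsm hgc D hfree).L)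
    ((Scheme.Modules.pullback ((A.quotientBy u K hcov hG hsm hgc).baseChangeToProd D.hat f₁ a' ha')).obj
          (A.poincarePullbackBundle u K hK hcov hG hsm hgc D hfree).L)
    h₀ h₁ h₁' e e' (fun σ => (A.baseChange f₁).X.hom.appTop (v σ)) (fun σ => (A.baseChange f₁).X.hom.appTop (v' σ)) hv hv' hrr
  -- read `(1 × τ)^*(1 × a)^*𝒩₁ ≅ (1 × (τ ≫ a))^*𝒩₁` and apply (K)
  obtain ⟨j⟩ := B.nonempty_pullback_prodMap_pullback_baseChangeToProd_iso D.hat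
    (A.poincarePullbackBundle u K hK hcov hG hsm hgc D hfree).L (τ ≫ f₁) f₁ τ rfl a ha
  obtain ⟨j'⟩ := B.nonempty_pullback_prodMap_pullback_baseChangeToProd_iso D.hat
    (A.poincarePullbackBundle u K hK hcov hG hsm hgc D hfree).L (τ ≫ f₁) f₁ τ rfl a' ha'
  have hψ := hStab (τ ≫ f₁) (τ ≫ a) (τ ≫ a') (by rw [Category.assoc, ha]) (by rw [Category.assoc, ha'])
    ⟨j.symm ≪≫ i ≪≫ j'⟩
  -- the fibres of `ψ̂` on field-valued points are `K′`-orbits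
  haveI := D.hat.isAffineHom_quotientMk_left u K' hcov'
  obtain ⟨κ', hκ'⟩ := (D.hat.isGeometricQuotient_quotientActionOver u K' hcov').exists_eq_comp_aut_of_comp_eq_of_free
    (D.hat.quotientActionOver_free u K' hcov' hfree') (τ ≫ a) (τ ≫ a') hψ
  exact ⟨κ', hκ'⟩

include hfree hfree' in
/-- **THE OPEN PIECES COVER THE DIVISION COVER** (the character correction, by counting at a geometric point).  Setting: `S` with
`n` invertible in its residue fields, a level-`n` structure `φ̂` on `Â`, `#K · #K′ = n^{2g}`, the stabiliser hypothesis (K) `hStab`;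
a lift `a : T₁ → Â` over `f₁`, a line bundle `F₀` on `B_{T₁}` and, for every `c ∈ (ℤ/n)^{2g}`, an isomorphism
`e_c : ψ^*((1 × a·φ̂(c))^*𝒩₁) ≅ ψ^* F₀` with discrepancy units `v_c` (§3).  Then every point `t₁ ∈ T₁` lies in SOME
`G_c = D(∏_σ Σ_{i<n} (v_c σ)^i)`: at a geometric point `τ` over `t₁`, `c ↦ (σ ↦ τ^♯(v_c σ)) ∈ Hom(K, Ω)` has fibres inside
`K′`-cosets of the basis `c ↦ φ̂(c)(s̄)` (§4 `exists_comp_eq_comp_translation_of_appTop_eq` + `φ̂.basis_injective`), its domain has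
`n^{2g} = #K · #K′` elements and its target at most `#K` (Dedekind–Artin), so it is onto (`surjective_of_card_fibre_le`) and hits the
trivial character: `τ^♯(v_{c₀} σ) = 1` for all `σ`, i.e. `τ^♯(∏_σ Σ_i v^i) = n^{#K}` is a unit and `t₁ ∈ G_{c₀}`.
[cite: MumfordAV1970, §15 Thm. 1 (p. 143)] [cite: MumfordFogartyKirwan1994, Ch. 7 §2 Definition 7.1 (p. 129)] -/
theorem exists_mem_basicOpen_levelTwist [IsCommMonObj D.hat.X] {g : ℕ} (φ : LevelStructure g n D.hat)
    (hn : ∀ s : S, (n : S.residueField s) ≠ 0) (hcard : Nat.card K * Nat.card K' = n ^ (2 * g))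
    (hStab : ∀ {T : Scheme.{u}} (f : T ⟶ S) (a a' : T ⟶ D.hat.X.left) (ha : a ≫ D.hat.X.hom = f)
      (ha' : a' ≫ D.hat.X.hom = f),
      Nonempty ((Scheme.Modules.pullback ((A.quotientBy u K hcov hG hsm hgc).baseChangeToProd D.hat f a ha)).obj
          (A.poincarePullbackBundle u K hK hcov hG hsm hgc D hfree).L ≅
        (Scheme.Modules.pullback ((A.quotientBy u K hcov hG hsm hgc).baseChangeToProd D.hat f a' ha')).obj
          (A.poincarePullbackBundle u K hK hcov hG hsm hgc D hfree).L) →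
      a ≫ (D.hat.quotientMk u K' hcov').left = a' ≫ (D.hat.quotientMk u K' hcov').left)
    {T₁ : Scheme.{u}} (f₁ : T₁ ⟶ S) (F₀ : ((A.quotientBy u K hcov hG hsm hgc).baseChange f₁).X.left.Modules) (h₀ : HasRank F₀ 1)
    (a : T₁ ⟶ D.hat.X.left) (ha : a ≫ D.hat.X.hom = f₁)
    (e : ∀ c : Fin g ⊕ Fin g → ZMod n,
      (Scheme.Modules.pullback (A.quotientMk u K hcov ▷ Over.mk f₁).left).obj
        ((Scheme.Modules.pullback ((A.quotientBy u K hcov hG hsm hgc).baseChangeToProd D.hat f₁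
          ((Over.homMk a ha : Over.mk f₁ ⟶ D.hat.X) * (toUnit (Over.mk f₁) ≫ φ.section_ c)).left (Over.w _))).obj
          (A.poincarePullbackBundle u K hK hcov hG hsm hgc D hfree).L) ≅
      (Scheme.Modules.pullback (A.quotientMk u K hcov ▷ Over.mk f₁).left).obj F₀)
    (v : (Fin g ⊕ Fin g → ZMod n) → (K →* Γ(T₁, ⊤)))
    (hv : ∀ (c : Fin g ⊕ Fin g → ZMod n) (σ : K),
      (Scheme.Modules.pullback ((translationActionOverWhiskerRight A (Over.mk f₁) u K hcov).autHom σ)).map (e c).hom ≫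
          ((ActionOver.EquivariantStructure.ofPullback (translationActionOverWhiskerRight A (Over.mk f₁) u K hcov) F₀).iso σ).hom =
        ((ActionOver.EquivariantStructure.ofPullback (translationActionOverWhiskerRight A (Over.mk f₁) u K hcov)
          ((Scheme.Modules.pullback ((A.quotientBy u K hcov hG hsm hgc).baseChangeToProd D.hat f₁
            ((Over.homMk a ha : Over.mk f₁ ⟶ D.hat.X) * (toUnit (Over.mk f₁) ≫ φ.section_ c)).left (Over.w _))).obj
            (A.poincarePullbackBundle u K hK hcov hG hsm hgc D hfree).L)).iso σ).hom ≫
          (e c).hom ≫ globalScalar ((Scheme.Modules.pullback (A.quotientMk u K hcov ▷ Over.mk f₁).left).obj F₀)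
            ((A.baseChange f₁).X.hom.appTop (v c σ)))
    (t₁ : T₁) :
    ∃ c : Fin g ⊕ Fin g → ZMod n, ∀ r : Γ(T₁, ⊤),
      (haveI := Fintype.ofFinite K; r = ∏ σ : K, ∑ i ∈ Finset.range n, v c σ ^ i) → t₁ ∈ T₁.basicOpen r := by
  classical
  letI : Fintype K := Fintype.ofFinite K
  letI : Fintype K' := Fintype.ofFinite K'
  -- a geometric point over `t₁`
  let Ω : Type u := AlgebraicClosure (T₁.residueField t₁)
  let τ : Spec (.of Ω) ⟶ T₁ :=
    Spec.map (CommRingCat.ofHom (algebraMap (T₁.residueField t₁) Ω)) ≫ T₁.fromSpecResidueField t₁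
  have hτ : ∀ y, τ.base y = t₁ := fun y => by
    change (T₁.fromSpecResidueField t₁).base ((Spec.map _).base y) = t₁
    exact Scheme.fromSpecResidueField_apply _ _
  have hnΩ : (n : Ω) ≠ 0 := natCast_ne_zero_of_specMap (τ ≫ f₁) (hn _)
  haveI : NeZero n := ⟨fun h => hnΩ (by rw [h, Nat.cast_zero])⟩
  let eΩ : Γ(Spec (CommRingCat.of Ω), ⊤) ≃+* Ω := (Scheme.ΓSpecIso (.of Ω)).commRingCatIsoToRingEquiv
  -- the pointwise discrepancy characters
  let d : (Fin g ⊕ Fin g → ZMod n) → (K →* Ω) := fun c => (eΩ.toMonoidHom.comp τ.appTop.hom.toMonoidHom).comp (v c)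
  have hd : ∀ c σ, d c σ = eΩ (τ.appTop (v c σ)) := fun c σ => rfl
  -- the restricted twisted points as `Ω`-points of the fibre `Â_{s̄}`, `s̄ = τ ≫ f₁`
  let B : AbelianSchemeOver S := A.quotientBy u K hcov hG hsm hgc
  let p : Over.mk f₁ ⟶ D.hat.X := Over.homMk a ha
  let τ' : Over.mk (τ ≫ f₁) ⟶ Over.mk f₁ := Over.homMk τ rfl
  have hres : ∀ c : Fin g ⊕ Fin g → ZMod n,
      τ ≫ (p * (toUnit (Over.mk f₁) ≫ φ.section_ c)).left =
        ((τ' ≫ p) * D.hat.restrict (τ ≫ f₁) (φ.section_ c)).left := by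
    intro c
    change (τ' ≫ (p * (toUnit (Over.mk f₁) ≫ φ.section_ c))).left = _
    rw [MonObj.comp_mul, ← Category.assoc, comp_toUnit]
  -- `c ↦ τ ≫ (a·φ̂(c))` is injective (the level basis is injective on the geometric fibre)
  have hinj0 : Function.Injective fun c : Fin g ⊕ Fin g → ZMod n =>
      τ ≫ (p * (toUnit (Over.mk f₁) ≫ φ.section_ c)).left := by
    intro c c' hcc'
    have h1 : (τ' ≫ p) * D.hat.restrict (τ ≫ f₁) (φ.section_ c) = (τ' ≫ p) * D.hat.restrict (τ ≫ f₁) (φ.section_ c') := by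
      apply Over.OverMorphism.ext
      rw [← hres c, ← hres c']
      exact hcc'
    exact φ.basis_injective (τ ≫ f₁) (mul_left_cancel h1)
  -- the fibres of `d` lie in `K′`-cosets
  have hfib : ∀ h : K →* Ω, Nat.card {c // d c = h} ≤ Nat.card K' := by
    intro h
    rcases isEmpty_or_nonempty {c // d c = h} with hemp | ⟨⟨c₁, hc₁⟩⟩
    · rw [Nat.card_of_isEmpty]; exact Nat.zero_le _
    have key : ∀ x : {c // d c = h}, ∃ κ' : K',
        τ ≫ (p * (toUnit (Over.mk f₁) ≫ φ.section_ x.1)).left =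
          (τ ≫ (p * (toUnit (Over.mk f₁) ≫ φ.section_ c₁)).left) ≫ (D.hat.translation (κ' : D.hat.Sections)).left := by
      intro x
      refine A.exists_comp_eq_comp_translation_of_appTop_eq u K hK hcov hG hsm hgc D hfree K' hcov' hfree' hStab f₁ F₀ h₀
        _ _ (Over.w _) (Over.w _) (e c₁) (e x.1) (v c₁) (v x.1) (hv c₁) (hv x.1) τ fun σ => ?_
      apply eΩ.injective
      rw [← hd, ← hd, hc₁, x.2]
    choose κ hκ using key
    refine Nat.card_le_card_of_injective κ fun x y hxy => Subtype.ext (hinj0 ?_)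
    change τ ≫ (p * (toUnit (Over.mk f₁) ≫ φ.section_ x.1)).left = τ ≫ (p * (toUnit (Over.mk f₁) ≫ φ.section_ y.1)).left
    rw [hκ x, hκ y, hxy]
  -- counting
  have hKc : Finite (K →* Ω) ∧ Nat.card (K →* Ω) ≤ Nat.card K := finite_monoidHom_and_natCard_le K Ω
  haveI := hKc.1
  have hq : 0 < Nat.card K' := Nat.card_pos
  have hX : Nat.card (Fin g ⊕ Fin g → ZMod n) = Nat.card K * Nat.card K' := by
    rw [hcard, Nat.card_eq_fintype_card, Fintype.card_fun, ZMod.card, Fintype.card_sum, Fintype.card_fin, two_mul]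
  obtain ⟨c₀, hc₀⟩ := surjective_of_card_fibre_le d hq hX hKc.2 hfib (1 : K →* Ω)
  refine ⟨c₀, fun r hr => ?_⟩
  -- at `c₀` every `v σ` pulls back to `1`, so `∏_σ Σ_i v^i` pulls back to the unit `n ^ #K`
  have hv1 : ∀ σ : K, τ.appTop (v c₀ σ) = 1 := fun σ =>
    eΩ.injective (by rw [← hd, hc₀, MonoidHom.one_apply, map_one])
  have hunit : IsUnit (τ.appTop r) := by
    rw [hr, map_prod]
    simp only [map_sum, map_pow, hv1, one_pow, Finset.sum_const, Finset.card_range, nsmul_eq_mul, mul_one,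
      Finset.prod_const]
    exact (isUnit_natCast_ΓSpec hnΩ).pow _
  rw [← hτ (IsLocalRing.closedPoint Ω)]
  exact mem_basicOpen_of_isUnit_appTop τ r hunit _

end Fibre

end AbelianSchemeOver

end Literature.AlgebraicGeometry.AbelianSchemes

end
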